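import Summits.BirchSwinnertonDyer.BirchSwinnertonDyer.Theorems.PrintX9HowardContainmentPinnedOfSixLeavesIntended
import Summits.BirchSwinnertonDyer.BirchSwinnertonDyer.Theorems.PrintX10bHowardContainmentPinnedOfThreeLeaves
import HarnessLib

/-!
# T-161′-X10b — row 10's A-side and displays re-derived against the PRINT-AS-INTENDED Howard leaf F-161′
# (`Howard2004.thm161_dvrKolyvaginBound_printIntended`): `howardContainmentLightFrameX10bPinned_of_howardIntended_kolyvaginSystem_cgs`,
# `wallCornerX10b_of_sixLeaves_intended`, `bsdpOnClassX10b_of_sixLeaves_intended`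

Cell `pub/bsd-print-x9`, seat `bsd-line-x9-p1` LEAD g10 (the X10b twin of this seat's `PrintX9HowardContainmentPinnedOfSixLeavesIntended`, as
x9-p1 LEAD g7's p696595 was the twin of p695713); pen plan g15 TURNKEY T-161′-X10b (2026-08-29T08:35:01Z); referee REF-167/169/169a; lit g45's
F-161′. `--supports` stmt-BirchSwinnertonDyer-22642 (`stub_h161` = F-161). THEOREMS ONLY (no definition, no named fact, no instance, no `sorry`).

WHY. Row 10's displays `PrintX10bOfKSLeaf.wallCornerX10b_of_sixLeaves` / `bsdpOnClassX10b_of_sixLeaves` (p696595) take F-161 =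
`Howard2004.thm161_dvrKolyvaginBound` (print-as-WORDED). The G87 ENGINE proves Thm. 1.6.1 print-as-INTENDED = F-161′ (guards
`((p : ℕ) : R) ≠ 0`, `¬ p ∣ Nat.card (𝓞 K)ˣ`). On an odd-`d_K` X10b Heegner frame (`p = 3`, `d_K` odd, `d_K ≠ −3` — recorded in the frame
binders `hodd`, `h3` of `HowardContainmentLightFrameX10bPinned` and carried into `Thm413Hypotheses` by `X10.thm413Hypotheses_of_classX10`)
both guards are free at the one application site (inside `PrintX9OfKolyvaginSystemLeafIntended.portCyclic_anyClassNumber_intended`: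
`R = Λ/(X^m + 3)` has `3 ≠ 0`; `d_K < −4 ⇒ #𝓞_K^× = 2 ∌ 3`). Everything else is p696595 VERBATIM with the F-161′ coherent-pair letter
`exists_coherentPair_isTorsion_muIneq_of_howardIntended_kolyvaginSystem_anyClassNumber` for p691788 §2.

* `pinnedContainment_oddDisc_at_of_howardIntended_kolyvaginSystem_cgs (hH' hK hCGS)` — p696595 §1 twin (given `jbar`).
* **`howardContainmentLightFrameX10bPinned_of_howardIntended_kolyvaginSystem_cgs :
  F-161′ → CGLSHeegnerKolyvaginSystem → CGSHowardDivisibilityPLocalized → HowardContainmentLightFrameX10bPinned`** (item 27274's decl).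
* **`wallCornerX10b_of_sixLeaves_intended` / `bsdpOnClassX10b_of_sixLeaves_intended (hH' hK hCGS hPT hHP hP)`** — row 10's corner and leaf
  from SIX cite-only binders with F-161′ for F-161.
HONEST FRAMING: CONDITIONAL on the leaves named; no item is closed by this file; no route verb is implied (re-pointing `hH` is the pen's
D-0059 round). «beyond-print theorem»: no. No summit statement is proved; thm161 is NOT proved; BSD is NOT proved by any of this.

References: [Howard2004HeegnerKolyvagin] Thm. 1.6.1 (arXiv Thm. 2.6.1), p. 3 L23–25, p. 4 L47–51, proof of Thm. 2.2.10, Thm. B;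
[CastellaGrossiLeeSkinner2022] Thm. 4.1.1, Rem. 4.1.4, §3.2; [CastellaGrossiSkinner2025] Thm. 6.5.2; [PerrinRiou1987BSMF] §3.4 Prop. 10;
[Washington1997] §13.2.
-/

set_option linter.dupNamespace false
set_option autoImplicit false

noncomputable section

open scoped Classical Pointwise
open Literature Literature.NumberTheory.EllipticCurves WeierstrassCurve
  Literature.NumberTheory.EllipticCurves.ModularForms
  Literature.NumberTheory.EllipticCurves.CastellaGrossiLeeSkinner2022
  Literature.NumberTheory.GaloisCohomology.Howard2004
open Literature.NumberTheory.EllipticCurves.Rank1Residual (ClassX10 Surj)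
open Summit.BirchSwinnertonDyer.BirchSwinnertonDyer.Theses.PrintX10b
  (HowardDVRKolyvaginBound CGLSHeegnerKolyvaginSystem CGSHowardDivisibilityPLocalized
    HowardContainmentLightFrameX10bPinned PinnedTransferPrintFacts HeegnerPrintFactsX10b PrintFactsX10b)
open Summit.BirchSwinnertonDyer.BirchSwinnertonDyer.Theorems
open Summit.BirchSwinnertonDyer.BirchSwinnertonDyer.Theorems.PrintX9OfKolyvaginSystemLeafIntended
  (exists_coherentPair_isTorsion_muIneq_of_howardIntended_kolyvaginSystem_anyClassNumber)

namespace Summit.BirchSwinnertonDyer.BirchSwinnertonDyer.Theorems.PrintX10bOfKSLeafIntended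

/-! ## §1 The pinned containment for a GIVEN `jbar` on an odd-`d_K` X10b frame, from F-161′, F-411, CGS 6.5.2 -/

/-- **The PINNED Howard containment on an odd-`d_K` X10b Heegner frame with (irr_K), for a given `jbar`, from F-161′
(`thm161_dvrKolyvaginBound_printIntended`), CGLS 2022 Thm. 4.1.1 in Kolyvagin-system form and CGS 2025 Thm. 6.5.2 ONLY** — p696595 §1
VERBATIM with the F-161′ coherent-pair letter. ANY class number, ANY Selmer corank.
[cite: Howard2004HeegnerKolyvagin, Thm. 1.6.1 and proof of Thm. 2.2.10] [cite: CastellaGrossiLeeSkinner2022, Thm. 4.1.1, Rem. 4.1.4]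
[cite: CastellaGrossiSkinner2025, Thm. 6.5.2] [cite: Washington1997, §13.2] -/
theorem pinnedContainment_oddDisc_at_of_howardIntended_kolyvaginSystem_cgs
    (hH' : thm161_dvrKolyvaginBound_printIntended) (hK : CGLSHeegnerKolyvaginSystem) (hCGS : CGSHowardDivisibilityPLocalized)
    {W : WeierstrassCurve ℚ} [W.IsElliptic] [W.IsGloballyMinimal] {p : ℕ} [Fact p.Prime]
    [NeZero (W.conductorNorm ℤ)] {K : Type} [Field K] [NumberField K]
    (hX : ClassX10 W p) (hKq : IsImaginaryQuadratic K)
    (hodd : Odd (NumberField.discr K)) (h3 : NumberField.discr K ≠ -3)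
    (hHN : SatisfiesHeegnerHypothesis (W.conductorNorm ℤ) K) (hHp : SatisfiesHeegnerHypothesis p K)
    (hirr : (W.baseChange K).HasIrreducibleModPGaloisRep p)
    {κ : ZpExtension K p} (hκ : κ.IsAnticyclotomic) {γ : Field.absoluteGaloisGroup K} (hγ : κ.IsTopGenerator γ)
    (Dt : ModularParametrizationData W (W.conductorNorm ℤ))
    (H : HeegnerDatum (W.conductorNorm ℤ) (NumberField.discr K)) (jbar : AlgebraicClosure K →+* ℂ) :
    ∃ (D : (W.baseChange K).LambdaAdicSelmerData κ γ) (F : HeegnerFamily (W.conductorNorm ℤ) W K κ jbar)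
      (X : (W.baseChange K).SelmerDualData κ γ),
      F.Dt = Dt ∧ heegnerCharIdeal D F ^ 2 ≤
        Module.charIdeal (IwasawaAlgebra p) (Submodule.torsion (IwasawaAlgebra p) X.X) := by
  have hp : p.Prime := Fact.out
  obtain ⟨D⟩ := LambdaAdicSelmerDataExists.nonempty_lambdaAdicSelmerData (W.baseChange K) p κ hγ
  obtain ⟨X⟩ := (W.baseChange K).nonempty_selmerDualData_holds κ γ hγ
  have hyp := Summit.BirchSwinnertonDyer.BirchSwinnertonDyer.Rank1Residual.X10.thm413Hypotheses_of_classX10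
    hX hKq h3 hHN hHp hodd hκ hγ
  have hirrQ : W.HasIrreducibleModPGaloisRep p := by
    obtain ⟨rfl, -⟩ := id hX
    exact hX.irr
  have hTw1 : ∀ k : ℕ, ringClassSubgroup K (p ^ (k + 1)) jbar ≤ κ.layerSubgroup k :=
    fun k ↦ anticyclotomicTowerSharp K p (hp.odd_of_ne_two hX.ne_two) hKq κ hκ jbar k
  -- the CGLS leaf, by name
  have hKS : thm411_exists_kolyvaginSystem_one_ne_zero := hK
  -- the any-class-number coherent-pair letter at `(Dt, H.β, D, X)` from F-161′: pair, envelopes, torsion and μ from rank one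
  obtain ⟨C, F, -, hFDt, -, -, hle, ⟨g, hg, hrev⟩, htf, hμC⟩ :=
    exists_coherentPair_isTorsion_muIneq_of_howardIntended_kolyvaginSystem_anyClassNumber hH' hKS
      (W.conductorNorm ℤ) W K p κ γ jbar hyp hirrQ hirr hHp hX.not_dvd_conductorNorm hTw1
      (card_ringClassGalOver_prime_one_of_frame hKq hodd h3 hp hHp jbar) Dt H.β H.dvd_sq_sub D X
  -- CGS Thm. 6.5.2 BY NAME at `(D, C, X)`: finiteness, `Λ`-rank one, the p-localized bound in C-currency
  have h652 : CastellaGrossiSkinner2025.thm652_stabilized_rankOne_charIdeal_torsion_dvd_pLocalized.{0} := hCGS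
  obtain ⟨⟨hfinS, hS1⟩, hfinX, -⟩ := h652 (W.conductorNorm ℤ) W K p κ γ jbar hyp D C X
  haveI := hfinS
  haveI := hfinX
  obtain ⟨hfree, htorC⟩ := htf hfinS hS1
  haveI := hfree
  obtain ⟨m, hm⟩ := CastellaGrossiSkinner2025.span_pow_mul_sq_le_charIdeal_torsion_of_thm652_stabilized h652
    hyp D C X
  -- the μ-inequality at `C` (derived from rank one) promotes the p-localized bound
  haveI : IsNoetherian (IwasawaAlgebra p) X.X := isNoetherian_of_isNoetherianRing_of_finite _ _
  haveI : Module.Finite (IwasawaAlgebra p) (Submodule.torsion (IwasawaAlgebra p) X.X) := inferInstance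
  haveI : Module.Finite (IwasawaAlgebra p) (D.S ⧸ stabilizedHeegnerModule D C) := inferInstance
  have hsqC : stabilizedHeegnerCharIdeal D C ^ 2 ≤
      Module.charIdeal (IwasawaAlgebra p) (Submodule.torsion (IwasawaAlgebra p) X.X) := by
    rw [stabilizedHeegnerCharIdeal_def] at hm ⊢
    exact IwasawaAlgebra.sq_charIdeal_le_charIdeal_of_span_p_pow_mul_le_of_lengthAt_le_two_mul
      (Submodule.torsion_isTorsion (R := IwasawaAlgebra p) (M := X.X)) htorC (hμC hfinS hfinX hS1) hm
  -- torsion of `𝔖/ℋ_F` from the reverse inclusion, then `I(ℋ_F) ≤ I(Λκ_C)` from the forward inclusion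
  have htor : Module.IsTorsion (IwasawaAlgebra p) (D.S ⧸ heegnerModule D F) :=
    isTorsion_quotient_heegnerModule_of_smul_stabilizedHeegnerModule_le D F C hg hrev htorC
  have hIF : heegnerCharIdeal D F ≤ stabilizedHeegnerCharIdeal D C :=
    heegnerCharIdeal_le_stabilizedHeegnerCharIdeal_of_le D F C htor hle
  exact ⟨D, F, X, hFDt, (Ideal.pow_right_mono hIF 2).trans hsqC⟩

/-! ## §2 The light pinned containment (27274) from F-161′, F-411, CGS 6.5.2 -/

/-- **`HowardContainmentLightFrameX10bPinned` (stmt-BirchSwinnertonDyer-27274) from F-161′, F-411, CGS 6.5.2** — p696595 §2 twin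
(§1 with `jbar := IsAlgClosed.lift` along `ιC`; the frame's `¬ Surj W 3`, `¬ W.HasCM`, `hc`, `hrk`, `hfin` idle).
[cite: Howard2004HeegnerKolyvagin, Thm. 1.6.1] [cite: CastellaGrossiLeeSkinner2022, Thm. 4.1.1] [cite: CastellaGrossiSkinner2025, Thm. 6.5.2] -/
theorem howardContainmentLightFrameX10bPinned_of_howardIntended_kolyvaginSystem_cgs
    (hH' : thm161_dvrKolyvaginBound_printIntended) (hK : CGLSHeegnerKolyvaginSystem) (hCGS : CGSHowardDivisibilityPLocalized) :
    HowardContainmentLightFrameX10bPinned := by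
  intro W _ _ p _ _ K _ _ hX _hns _hcm hKq hodd h3 hHN hHp hirr κ hκ γ hγ Dt H ιC _hc _hrk _hfin
  letI : Algebra K ℂ := ιC.toAlgebra
  let jbar : AlgebraicClosure K →+* ℂ :=
    (IsAlgClosed.lift (R := K) (M := ℂ) (S := AlgebraicClosure K)).toRingHom
  obtain ⟨D, F, X, hFDt, h⟩ := pinnedContainment_oddDisc_at_of_howardIntended_kolyvaginSystem_cgs hH' hK hCGS hX hKq hodd
    h3 hHN hHp hirr hκ hγ Dt H jbar
  exact ⟨jbar, D, F, X, hFDt, h⟩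

/-! ## §3 Displays: the row-10 corner and the X10b leaf from SIX cite-only binders, F-161′ for F-161 -/

/-- **DISPLAY — the W-ALL row-10 corner `WAllCornerX10b` from SIX cite-only binders with F-161′ in place of F-161**: Howard 2004
Thm. 1.6.1 print-as-intended (`hH'`), CGLS 2022 Thm. 4.1.1 KS form (`hK`), CGS 2025 Thm. 6.5.2 (`hCGS`), `PinnedTransferPrintFacts`,
`HeegnerPrintFactsX10b`, `PrintFactsX10b` — p696595's `wallCornerX10b_of_sixLeaves` with §2 for the A-side. CONDITIONAL; a display, not
a closure. [cite: Howard2004HeegnerKolyvagin, Thm. 1.6.1] [cite: CastellaGrossiLeeSkinner2022, Thm. 4.1.1] [cite: CastellaGrossiSkinner2025, Thm. 6.5.2] -/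
theorem wallCornerX10b_of_sixLeaves_intended
    (hH' : thm161_dvrKolyvaginBound_printIntended) (hK : CGLSHeegnerKolyvaginSystem) (hCGS : CGSHowardDivisibilityPLocalized)
    (hPT : PinnedTransferPrintFacts) (hHP : HeegnerPrintFactsX10b) (hP : PrintFactsX10b) :
    Summit.BirchSwinnertonDyer.WAllCornerX10b :=
  Summit.BirchSwinnertonDyer.Rank1Residual.WAll.wallCornerX10b_of_bsdpOnClassX10b
    (PrintX10bAssemblyLightTwinsX10b.assemblyLightTwinsX10b_proof
      (howardContainmentLightFrameX10bPinned_of_howardIntended_kolyvaginSystem_cgs hH' hK hCGS)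
      (PrintX10bPinned.twoSidedLinkAnyClassNumberX10bPinnedOfPrint_holds hPT hHP)
      hHP Summit.BirchSwinnertonDyer.BirchSwinnertonDyer.Cruxes.AnalyticMuZeroX10b.TheoremB.AnalyticMuZeroX10b_of hP)

/-- **DISPLAY — the partition leaf `X10.BSDpOnClassX10b` from the same SIX cite-only binders, F-161′ for F-161** (through the light
assembly). [cite: Howard2004HeegnerKolyvagin, Thm. 1.6.1] [cite: CastellaGrossiLeeSkinner2022, Thm. 4.1.1] [cite: CastellaGrossiSkinner2025, Thm. 6.5.2] -/
theorem bsdpOnClassX10b_of_sixLeaves_intended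
    (hH' : thm161_dvrKolyvaginBound_printIntended) (hK : CGLSHeegnerKolyvaginSystem) (hCGS : CGSHowardDivisibilityPLocalized)
    (hPT : PinnedTransferPrintFacts) (hHP : HeegnerPrintFactsX10b) (hP : PrintFactsX10b) :
    Summit.BirchSwinnertonDyer.Rank1Residual.X10.BSDpOnClassX10b :=
  PrintX10bAssemblyLightTwinsX10b.assemblyLightTwinsX10b_proof
    (howardContainmentLightFrameX10bPinned_of_howardIntended_kolyvaginSystem_cgs hH' hK hCGS)
    (PrintX10bPinned.twoSidedLinkAnyClassNumberX10bPinnedOfPrint_holds hPT hHP)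
    hHP Summit.BirchSwinnertonDyer.BirchSwinnertonDyer.Cruxes.AnalyticMuZeroX10b.TheoremB.AnalyticMuZeroX10b_of hP

end Summit.BirchSwinnertonDyer.BirchSwinnertonDyer.Theorems.PrintX10bOfKSLeafIntended

end
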